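import Mathlib
import HarnessLib
import HarnessLib.Audit
import Summits.HodgeConjecture.Statement
import Summits.HodgeConjecture.HodgeConjecture.Theorems.Ring2SemiregularRepresentativesVHC
import Summits.HodgeConjecture.HodgeConjecture.Theorems.Ring2SemiregularRepresentativesLef
import Summits.HodgeConjecture.HodgeConjecture.Theorems.Ring2BindersAbelianSchemeVHCRaynaud
import Literature.AlgebraicGeometry.HodgeTheory.ChernCharacterBetti
import Literature.AlgebraicGeometry.HodgeTheory.SemiregularityMap
import Literature.AlgebraicGeometry.HodgeTheory.SemiregularVariationalHodgeTwistedPerfect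
import Summits.HodgeConjecture.HodgeConjecture.Theorems.VHCAbelianSchemesRoadTwistedDoor
import Summits.HodgeConjecture.HodgeConjecture.Theorems.VHCAbelianSchemesRoadDiagonal
import Literature.AlgebraicGeometry.Andre1996.WeilClassesAlgebraicallyAnchoredPencil
import Literature.AlgebraicGeometry.HodgeTheory.KodairaEmbeddingHyperplaneClass
import Summits.HodgeConjecture.HodgeConjecture.Theorems.AndreAnchoredPencilsAlgebraicOfKodairaRouteFree
import Literature.AlgebraicGeometry.HodgeTheory.TwistedPerfectAdmissibilityInitialSegment
import Summits.HodgeConjecture.HodgeConjecture.Theorems.VHCAbelianSchemesRoadDiagonalPrime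
import Summits.HodgeConjecture.HodgeConjecture.Theorems.VHCAbelianSchemesRoadRegimeAdditiveKernel
import Summits.HodgeConjecture.HodgeConjecture.Theorems.VHCAbelianSchemesRoadRegimeLocal
import Literature.AlgebraicGeometry.HodgeTheory.SecantQuotientJacobianTwistedCarrierForall
import HarnessLib.Audit.Status.Attr

/-!
Route: VHCAbelianSchemesRoad

# Route VHCAbelianSchemesRoad — Semiregular sheaf carriers with Lefschetz correction at some fibre
of an abelian pencil give VHC for abelian schemes and HC for abelian varieties

D-0059 road b02 (director-hodge, 2026-08-25; dossier vhodge ROUTE-P4 + the Buchweitz–Flenner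
statements-first file), filed by the ring2
LEAD/typer1 as a BRIEF, v2.2 (supersedes v1 4b48fd7d5bdc8760 — T1(a), vhodge-p4 g6 — and v2.1
00df18a994e86095 — its crux K-SR was
VACUOUS given `AbelianSchemeVHC`: null carrier, Z := −W, kernel certificate
`Ring2SemiregularRepresentativesVacuity.lean` 9615c188cefad2ff,
vhodge-p4 g7; director-hodge «20:41:20Z»: re-type, in the form of Bloch (7.5) as widened by van
Geemen 1994 §2.4); research route conditional on HC_CM; not a corollary;
Q11.4-sentence-2 already refuted in dim ≥ 3 — and on THIS road HC_CM is consumed nowhere. It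
suffices, FOR THE LEAF HC_AV (the
Hodge conjecture for complex abelian varieties, `Theses.PadicSemiregularLift.HodgeAbelianVarieties`,
the H1 rung closer — NOT the sub
Statement `HodgeConjecture`), to show X = K-C ∧ K-SR♭∃: K-C = a Chern character theory on complex
Betti cohomology with Fulton's laws exists
(`ChernCharacterOnBetti`, a construction the tree lacks), K-SR♭∃ = on every one-parameter abelian
scheme over a smooth affine curve with a
section, every fibrewise rational (p,p) global class W that is algebraic on one fibre has, on SOME
fibre, up to a non-zero scalar and a
global correction Z that is a LEFSCHETZ class (a divisor polynomial, `divisorClassesSpan`) on every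
fibre — in the form of Bloch 1972 Remark (7.5)
`a·z₀ + b·l₀ᵖ` as widened by van Geemen 1994 §2.4 (divisor polynomials in place of `l₀ᵖ`) — an
I-semiregular locally free SHEAF carrier whose other Chern character components are restrictions of
fibrewise-Hodge global classes (`SemiregularSheafRepresentativesLefAt`). Then Buchweitz–Flenner Thm.
5.1 (tree fact) is the door,
Ehresmann transport at the chosen fibre gives ring 2's node (U)
`OneParameterAbelianSchemeVHCUncountable`,
ring 2's exactness gives `Ring2.Hypotheses.AbelianSchemeVHC` (row b02 — the REDIRECT NODE of this
route: alone it is HC_AV restated modulo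
the two printed André-1996 facts, tree `Ring2.Deform.HC_AV_iff_abelianSchemeVHC_of_andre1996`), and
André 1996 closes HC_AV. Realises no
idea card (director road).
Lean: `Summit.HodgeConjecture.HodgeConjecture.Ring2.SemiregularRepresentatives.ChernCharacterOnBetti
∧
Summit.HodgeConjecture.HodgeConjecture.Ring2.SemiregularRepresentatives.SemiregularSheafRepresentativesLefAt`

## Assembly
K-C and K-SR♭∃ give, with the BF fact, `LocalVariationalHodgeFor (bfSheafClass C)` and a
Lefschetz-corrected carrier at some fibre s₁, hence
ring 2's node (U)
(`Summit.HodgeConjecture.HodgeConjecture.Ring2.SemiregularRepresentatives.oneParameterAbelianSchemeVHCUncountable_of_lefAt`: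
door at the model
`Iso.refl 𝒳_s₁`, Ehresmann transport of κ_p = a·W| + Z| along paths, Z| algebraic ⇒ W| algebraic on
an open set ∋ s₁ ⇒ uncountably many
algebraic fibres), hence `AbelianSchemeVHC` granted the curve residual (from Raynaud's fact; ring
2's
`abelianSchemeVHC_of_uncountable_of_oneParameterAbelianSchemeQuasiProjective`), hence HC_AV by
`Ring2.Deform.HC_AV_iff_abelianSchemeVHC_of_andre1996`
— all kernel-checked in carrier-v2; the deciding theorem in glue.lean is the one term
`Summit.HodgeConjecture.HodgeConjecture.Ring2.SemiregularRepresentatives.hc_av_of_semiregularSheafRepresentativesLefAt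
hC hSR hBF (Ring2.Binders.oneParameterAbelianSchemeQuasiProjective_of_raynaud1970 hR) h21 h22`.
It concludes the LEAF; against the sub Statement it is glue.conclusion-mismatch by design until
HC_AV is a live alternative closer.

CLOSES_TARGET: closes rung H1 of HodgeConjecture: Summit.HodgeConjecture.HodgeConjecture.Theses.PadicSemiregularLift.HodgeAbelianVarieties (D-0061; not the summit Statement) — the deciding theorem of this route concludes that registered leaf instead of the Statement decl `HodgeConjecture` (class rung: servable and labelled, never counted as concluding the summit Statement).

Rationale: WHY THIS LINE. (research route conditional on HC_CM; not a corollary; Q11.4-sentence-2 already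
refuted in dim ≥ 3.) Mechanism: deformation of algebraicity through SEMIREGULAR (TWISTED) SHEAVES —
Bloch1972Semiregularity Remark (7.5) / Thm. (7.4) in the
sheaf form of BuchweitzFlenner2003 §5 Thm. 5.1 (an I-semiregular sheaf on one fibre whose Chern
character components stay Hodge under flat
transport deforms, so its classes are algebraic nearby) and in its μ_r-TWISTED form
(B-field-corrected Chern characters κ of semiregular twisted
reflexive sheaves / twisted perfect complexes: infinitesimal statement [cite:
Pridham2024Semiregularity, Rem. 2.26 with Cor. 2.25 / Rem. 2.27] REFEREED (infinitesimal / formal: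
the Hodge locus of B-twisted Chern classes of a perfect complex); global statement for families
PREPRINT-sourced — [Markman2025SecantWeil §7.3 statement 7.3.9, proved for families of abelian
varieties in §7.5.2] and [Perry2026Semiregularity Thm. 1.1 (2)]; CAVEAT: Markman's σ_𝓑 vs Pridham's
𝓛 comparison UNVERIFIED in print (Markman fn. p. 6); for AdmTw's BF-sheaf disjunct with B₀ = 0 it is
the refereed tree fact BuchweitzFlenner2003 Thm. 5.1), composed with ring 2's lattice (germ node ⟹
`AbelianSchemeVHC` over smooth affine curves,
`Ring2.Binders.abelianSchemeVHC_iff_germ_of_oneParameterAbelianSchemeQuasiProjective`) and with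
Andre1996Motifs §6.3 Lemmes 6.3.1–6.3.3 (compact
CM-anchored pencils: `AbelianSchemeVHC` ⟺ HC_AV modulo two named facts). Imported from deformation
theory of coherent sheaves (semiregularity maps,
derived deformation theory of twisted perfect complexes) into Hodge theory; Grothendieck1966
footnote 13 is the statement being served. What it does
that the tree's other HC_AV lines do not: it is HC_CM-FREE and R3anc-FREE, and it isolates the ONE
statement that «b02 by known VHC techniques» needs
beyond print — K-SR♭∃ over the TWISTED door, `SemiregularSheafRepresentativesTwAt` — typed over ring
2's germ-node binders verbatim (carrier-v2
`Theorems/Ring2SemiregularRepresentativesLef.lean`, p408365, door-generic: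
`AdmissibleRepresentativesLefAt 𝒪`, `hc_av_of_lefAt`) and over the twisted
object class `Literature.AlgebraicGeometry.HodgeTheory.twistedReflexiveClass` (definition item
defn-twistedReflexiveClass, p418024 (ACCEPTED 2026-08-26T02:38:20Z, commit 1d9df456cc9a)). REV 5
(this edit, ruling A1 of director-hodge
2026-08-25T22:39:44Z + 23:06:02Z): the untwisted crux `SemiregularSheafRepresentativesLefAt` (finite
locally free door `bfSheafClass`) had NO witness
in print even where HC_AV is known — the only carriers in print inside HC's known regime (Markman
arXiv:2502.03415 Thm 1.4.1 ∕ 1.5.1: semiregular secant sheaves on SPLIT Weil-type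
SIXFOLD pencils, Weil-type fourfolds being reached from them by degeneration (Cor. 1.6.1), not by a
printed fourfold carrier; split Weil sixfolds arXiv:2509.23403 Thm 1.2) are μ_r-twisted REFLEXIVE
sheaves, locally free only off (d+1)² surfaces — so the load-bearing crux is now its TWIN
over the twisted door, and the untwisted statement stays in the file as the special case (support;
transports into the twin by
`AdmissibleRepresentativesLefAt.mono` along `bfSheafClass C ≤
Literature.AlgebraicGeometry.HodgeTheory.twistedReflexiveClass C`). The content of K-SR♭∃ (either
door) is
EXACTLY the exceptional part of W (kernel: `lefschetz_of_lefschetzCarrier`,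
`nullCarrier_forces_lefschetz`, `nullDatum_fails_of_exceptional`,
`weilFourfold_defeats_lefschetzCarriers` from the barrier fact `Weil1977_exceptionalHodgeClasses`).
Every door of record (Bloch, Buchweitz–Flenner,
Pridham–Perry, Pridham Rem. 2.26 twisted, Bloch–Esnault–Kerz in char. 0) has the shape
`LocalVariationalHodgeFor 𝒪` of cell hsemireg; the binder
`TwistedPerfectDoor` is that statement for `𝒪 =
Literature.AlgebraicGeometry.HodgeTheory.twistedReflexiveClass C` BY NAME
(`Literature.AlgebraicGeometry.HodgeTheory.TwistedPerfectDoorVHC`, definition item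
defn-TwistedPerfectDoorVHC,
p418024 (ACCEPTED 2026-08-26T02:38:20Z, commit 1d9df456cc9a)) — a print/preprint INPUT, never
staffed, labelled honestly: REFEREED only for the infinitesimal statement (Pridham Rem. 2.26), the
global
algebraicity for families resting on PREPRINTS (Markman §7.5.2 for abelian families; Perry Thm 1.1),
with Markman's semiregularity-map comparison (fn.
p. 6) UNVERIFIED. RESTRICTED CRUXES (tribunal T2 ladder note, director-hodge 2026-08-26T02:32:20Z:
blanket VHC for abelian schemes ≥ HC_AV is in
print — Milne's endnote to Deligne 1982, Abdulali 1994 Thm 6.1, André 1996, BEK arXiv:1310.1773 p.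
3): no load-bearing crux of this route is
blanket VHC — `SemiregularSheafRepresentativesTwAt` is a CARRIER-EXISTENCE statement at SOME fibre
of a one-parameter abelian pencil (restricted by
POINT and by CLASS: admissible twisted semiregular carriers of a·W + Lefschetz),
`TwistedPerfectDoor` is VHC restricted BY CLASS (B-twisted Chern
characters of semiregular twisted perfect objects) and is a print-input binder,
`ChernCharacterOnBetti` is a construction, Raynaud / André ×2 are
print facts by name; the redirect node `AbelianSchemeVHC` (blanket) is NOT an item. REV 13/14 (ROUND
2, option (α) = A′, 2026-08-26T22:10Z; tribunal J PASS round 2, verdict a2dc53518d0c72f1): the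
deciding crux is RE-CUT TO THE DIAGONAL — `SemiregularSheafRepresentativesTwAtDiag`
(stmt-HodgeConjecture-19787) = regime 2 of K-SR♭∃ over the twisted door at the cells (2m, m), m ≥ 2
only — because that slice is ALL of the twin that `closes` consumes: Lieberman1968's lower shadow (p
↦ n − p below the middle) and the Brosnan–Fang–Nie–Pearlstein middle lift (𝒳 ↦ 𝒳 × CM factor, same
codimension, algebraicity loci preserved; BrosnanFangNiePearlstein2009) move every class of a pencil
(n, p) to a diagonal cell, fact-free (`Theorems/VHCAbelianSchemesRoadDiagonal.lean` p448719,
`hc_av_of_exceptionalRegimeAt_twisted_diagonal_two`); OLD ⟹ NEW is certified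
(`twAtDiag_of_semiregularSheafRepresentativesTwAt`, p450067) and the all-(n, p) twin 19274 stays in
the file as the stronger ASIDE parent with its registered v4 skeleton. PART Y (ab-andre-2 g56,
p469169 ∕ p469584 ∕ p469982 ∕ p470228 + §4 p471736, fact-free; on the NEW decl BY NAME since
p471736: `twAtDiag_ge_of_semiregularSheafRepresentativesTwAtDiag`,
`twAtDiag_frequently_of_semiregularSheafRepresentativesTwAtDiag`,
`hcAtDim_of_cmAbelianHodge_of_semiregularSheafRepresentativesTwAtDiag` — downward arrows only, no
converse): by pure padding (𝒳 ↦ 𝒳 × B) the LEAF HC_AV already follows from the five other binders +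
regime 2 on ANY TAIL m ≥ M₀ of diagonal cells (`hc_av_of_twAtDiagTail_four`, `hc_av_of_twAtDiag_ge`,
terminal form `hc_av_of_twAtDiag_frequently`) — so along the diagonal «closest to print» ((6,3),
(4,2)) and «logically weakest» (tails) point opposite ways; J RULING (round 2): KEEP (α) — only a
typing containing a print-reachable cell admits a plan-able rung, and the over-strength is certified
harmless (OLD ⟹ NEW ⟹ tail ⟹ frequently).

RANKED CRUXES. #2 SemiregularSheafRepresentativesTwAtDiag (crux, stmt-HodgeConjecture-19787; deps:
ChernCharacterOnBetti; difficulty: open-problem) — K-SR♭∃ over the twisted door ON THE DIAGONAL: for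
every Chern character theory C and every m ≥ 2, `LefAtExceptionalRegimeAt (twistedReflexiveClass C
AdmTw) (2m) m` — on every one-parameter abelian scheme of relative dimension 2m over a smooth
irreducible affine curve with a section, every fibrewise rational (m,m) global class W algebraic on
one fibre and EXCEPTIONAL somewhere has, on SOME fibre, an AdmTw-admissible twisted datum (a
semiregular μ_r-twisted reflexive sheaf ∕ twisted perfect complex with B-field,
`gluableSigmaAdmissible ∨ bfSingleAdmissible`) whose degree-m class is a·W| + Z| with a ≠ 0 and Z a
global class that is an algebraic LEFSCHETZ class on every fibre, the other components restrictions
of fibrewise-Hodge global classes. LABELS (J round 2, PART Y): the cells (4,2) and (6,3) are the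
MECHANISM rungs — crux-load-bearing, leaf-idle; the TAIL m ≥ 4 is LEAF-CRITICAL (it alone, with the
five other binders, closes HC_AV: `hc_av_of_twAtDiagTail_four`) and has no print contact at any
cell. (why it might fail, cell-wise: (4,2) — NO semiregular carrier on an abelian-FOURFOLD pencil is
in print (Markman reaches Weil-type fourfolds only by degeneration from sixfolds, arXiv:2502.03415
Cor. 1.6.1; the n = 2 secant sheaves have rank 0, p0026:L30), so on a generic-NS-rank-1 Weil-type
fourfold pencil the datum must have κ₂ = a·W|s + c·Θ² on the nose AND joint σ-injectivity; (6,3) — a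
printed carrier exists ONLY on SPLIT (disc −1) Weil-type sixfold pencils through the genus-3 secant
fibre (Thm 1.4.1 ∕ 1.5.1, preprint; split sixfolds also arXiv:2509.23403 Thm 1.2), none on NON-SPLIT
components, where Q11.4-sentence-2 is refuted in dim ≥ 3; m ≥ 4 — no print contact.)
[Markman2025SecantWeil, Markman2025SurveySecant, Pridham2024Semiregularity, BuchweitzFlenner2003,
Bloch1972Semiregularity, vanGeemen1994HodgeAV, BrosnanFangNiePearlstein2009, Lieberman1968,
Andre1996Motifs]
#3 ChernCharacterOnBetti (crux) — K-C (construction): a Chern character theory on complex Betti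
cohomology satisfying Fulton's laws exists — an instance of hsemireg's structure
`ChernCharacterBetti` (intended: cl ∘ ch). Load-bearing because both doors and K-SR♭∃ are
parametrised by C; the tree deliberately has no existence theorem for the structure. [difficulty: L]
(why it might fail: only as TYPED — the structure's laws quantify over all SchemeOver ℂ and all
modules and could be jointly unsatisfiable as stated (hsemireg's rescaling audit found no
inconsistency, but no model is built).) [Fulton1998, VoisinHodgeI2002]
#8 TwistedPerfectDoor (crux-kind binder) — NAMED INPUT, never staffed (crux-KIND only because every
binder of `closes` must be crux-kind, measured gate rule `glue.non-crux-hypothesis`); by name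
`Literature.AlgebraicGeometry.HodgeTheory.TwistedPerfectDoorVHC`: the local variational Hodge
statement for the twisted object class
`Literature.AlgebraicGeometry.HodgeTheory.twistedReflexiveClass C` (per-C named fact
`Literature.AlgebraicGeometry.HodgeTheory.TwistedPerfectDoorVHC C`, the route binder being its ∀-C
closure). Labels: infinitesimal statement [cite: Pridham2024Semiregularity, Rem. 2.26 with Cor. 2.25
/ Rem. 2.27] REFEREED (infinitesimal / formal: the Hodge locus of B-twisted Chern classes of a
perfect complex); global statement PREPRINT-sourced — [Markman2025SecantWeil §7.3 statement 7.3.9,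
proved for families of abelian varieties in §7.5.2] and [Perry2026Semiregularity Thm. 1.1 (2)];
CAVEAT: Markman's σ_𝓑 vs Pridham's 𝓛 comparison UNVERIFIED in print (Markman fn. p. 6); for AdmTw's
BF-sheaf disjunct with B₀ = 0 it is the refereed tree fact BuchweitzFlenner2003 Thm. 5.1. A
hypothesis `(hDoor : …)`; never proved here. [difficulty: literature-input] (why it might fail: as a
GLOBAL statement over all smooth projective families it is preprint-sourced (Markman Conj. 7.3.9 is
printed as a conjecture outside abelian families); a carrier mismatch between the tree's
semiregularity map for twisted perfect complexes and Pridham's is the typed risk.)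
[Pridham2024Semiregularity, Markman2025SecantWeil, Perry2026Semiregularity, BuchweitzFlenner2003]
#5 RaynaudSectionProjective — REFEREED NAMED FACT (Raynaud 1970 Thm. XI 1.4: an abelian scheme with
a section over a normal base is projective), giving ring 2's curve residual
`Ring2.Binders.OneParameterAbelianSchemeQuasiProjective` by
`oneParameterAbelianSchemeQuasiProjective_of_raynaud1970`. [difficulty: provable-now] (why it might
fail: only by mis-rendering — the base hypotheses of the Lean fact must match the tree's
`AbelianSchemeOver` with section.) [GortzWedhorn2023, Raynaud1970]
#6 AndreCMAnchoredPencil — REFEREED NAMED FACT (André 1996 Lemme 6.3.1): every Hodge class on a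
complex abelian variety sits on a compact CM-anchored pencil. [difficulty: provable-now] (why it
might fail: only by mis-rendering — the «compact, CM-anchored, one-parameter» data must be exactly
what `HC_AV_iff_abelianSchemeVHC_of_andre1996` consumes (it is, by that theorem's type).)
[Andre1996Motifs]
#7 AndreAnchoredPencilsAlgebraic — REFEREED NAMED FACT (André 1996 Lemmes 6.3.2–6.3.3): the CM
fibre's Hodge classes of such a pencil are algebraically anchored. [difficulty: provable-now] (why
it might fail: only by mis-rendering — if the Lean fact silently packaged HC_CM it would be stronger
than print (Literature seat to confirm the docstring's scope).) [Andre1996Motifs]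
ASIDES (kind `aside`; not binders of `closes`; never staffed as cruxes; claimable for a direct proof
at low priority): SemiregularSheafRepresentativesTwAt (stmt-HodgeConjecture-19274, rank 2 — the
all-(n, p) twin over the twisted door, regime 2 confined to the middle range 2 ≤ p ≤ n − 2 (PART W
p443066); the STRONGER parent of #2 (`twAtDiag_of_semiregularSheafRepresentativesTwAt` p450067);
aside since rev 14; registered v4 skeleton
`Cruxes/SemiregularSheafRepresentativesTwAt/Lines/birth.lean` 5bdc755d21b65f81 (stubs
`stub_exceptionalRegimeTw_midRange`, `stub_rung_sixfoldMiddleTw`) and its evidence chain n°1–n°9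
kept) · SemiregularSheafRepresentativesLefAt (stmt-HodgeConjecture-19779, the untwisted special case
over `bfSheafClass`, NOT STAFFED as typed — ruling A1; registered v4 skeleton affed814271aa5f3;
Disproof entry T1 = THEOREM g8 «no semi-homogeneous Weil carrier», support T2
`noSemihomogeneousWeilCarrier` over defn-IsSemiHomogeneous p418356) ·
AdmissibleSheafRepresentativesLefAt (stmt-HodgeConjecture-19170, the same statement δ-unfolded,
operator by-name item of the #15c rule) · BuchweitzFlennerSheafDoor (stmt-HodgeConjecture-19781, BF
2003 Thm. 5.1 model rendering — the door of the untwisted special case, a refereed print fact by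
name). Assembly items 19539 (rev-4 chain, closed·proved p441648, proof re-landed p471881 after the
rev-13 re-keying) and 19785 (rev-12 twin chain, closed) are bookkeeping.

TWO-LAYER PLAN. REGISTERED skeleton for #2 (BC3, by name):
`Cruxes/SemiregularSheafRepresentativesTwAtDiag/Lines/birth.lean` sha f5bd95782495b8c0, commit
0eff59941dbf, `ledger skeleton check` OK 2026-08-27T01:01:29Z by the tenure planner (LEAD gen 150) —
stubs registered on 19787: `stub_firstCell_fourfoldMiddleTw`, `stub_rung_sixfoldMiddleTw`,
`stub_diagonalTailTw` (= v2 of the LEAD gen 149 file `d0059-g149/b02-alpha/bc/TwAtDiag_birth.lean`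
b7127f9b…, evidence n°1 a651bab5a8ca0a2b, whose own tree write commit 27d43d906597 failed the
skeleton audit rc 20 `skeleton.extra-hypothesis` ×3 because the audit took its hypothesis-form `_of`
for the skeleton theorem; v2 = the three `stub_*` declarations BYTE-IDENTICAL, composition reshaped
only: `SemiregularSheafRepresentativesTwAtDiag_of : <crux decl by name>` from the stubs by name,
hypothesis form `…_of_cells`; evidence n°6); line card `Lines/birth.md` by ab-andre-2 g56, commit
b666f046ae6d (evidence n°2): CELL SPLIT of the diagonal — `stub_firstCell_fourfoldMiddleTw` (cell
(4,2): `LefAtExceptionalRegimeAt … 4 2`; MECHANISM rung inside HC's known regime — Weil-type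
fourfolds are algebraic by Markman 2025, tree fact
`Markman2025_weilClasses_algebraic_abelianFourfold` = the tribunal's s_case — but no printed
CARRIER; XL) · `stub_rung_sixfoldMiddleTw` (cell (6,3), NAME + STATEMENT byte-identical to the v4
rung: `∀ C, LefAtExceptionalRegimeSixfoldMiddle (twistedReflexiveClass C AdmTw)`; = the BC5 ∕ T3
PLAN-ONLY separating rung: split Weil sixfolds carry Markman's printed secant carrier (lever
EXERCISED), NON-SPLIT Weil-type sixfold pencils lie outside
`Markman2025_hodgeClasses_algebraic_abelian_dim_le_five` and outside arXiv:2509.23403 Thm 1.2 —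
technique OPEN in print; XL) · `stub_diagonalTailTw` (m ≥ 4: LEAF-CRITICAL, no print contact; XXL)
with `SemiregularSheafRepresentativesTwAtDiag_of_cells` (interval_cases; pure logic) and
`SemiregularSheafRepresentativesTwAtDiag_of` = it applied to the three stubs, concluding the route
decl by name (NOT closed: sorryAx via the stubs, as designed), and the converse `stubs_of_twAtDiag`.
Foreseen glued split of a cell (not filed): by anchor type — split CM fibre E^{2m} (design problem
for twisted sheaves on E^{2m}; hsemireg line `semiregular-twin-hecke-vhc`) vs simple CM fibre, k =
2; J (F1): at André #22 anchors the cell-wise two-sided instrument (split complexes of line bundles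
admitted by `gluableSigmaAdmissible`; budgets 28 ∕ 495 ∕ 8008 at (4,2) ∕ (6,3) ∕ (8,4)) yields a
mechanism datum or a Negative lemma narrowing a cell to non-split objects.

KILL CRITERIA. The kill criterion now sits at the FIRST CELL (4,2): ONE one-parameter
abelian-fourfold pencil (natural candidate: a generic-NS-rank-1 Weil-type fourfold pencil with a CM
anchor) and a fibrewise-Hodge global class W algebraic at s₀ and exceptional somewhere such that NO
fibre carries an AdmTw-admissible twisted datum with κ₂ = a·W|s + c·Θ² (a ≠ 0) and joint
σ-injectivity (budget 28), in any Chern character theory, refutes #2 as typed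
(`refuted:SemiregularSheafRepresentativesTwAtDiag`) WITHOUT touching HC_AV (K-SR♭∃ is not implied by
HC_AV — HC_AV makes W algebraic, not semiregularly represented). REPAIR PATHS (J round 2,
superseding (β)/(γ′); each = REPAIR DUTY = another round, not a new route; no pre-emptive slide):
(β′) (4,2) refuted ⇒ slice m ≥ 3 with the SAME six binder kinds and NO residual
(`hc_av_of_exceptionalRegimeAt_twisted_diagonal_three` ∕ `hc_av_of_twAtDiag_ge hC 3`, fact-free; BC1
stays 6); further deaths ⇒ slide the window up (`hc_av_of_twAtDiag_ge hC M₀`, every M₀); terminal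
form «regime 2 at infinitely many diagonal cells» (`hc_av_of_twAtDiag_frequently`); (γ′)
HC_CM-conditional slices WITHDRAWN — HC_CM is idle for HC_AV on this road (PART Y-c: it buys only
`HCAtDim g` from one cell (2M, M), M ≥ 2g − 2). A proof that `ChernCharacterBetti` is uninstantiable
closes the route `refuted:ChernCharacterOnBetti` and sends hsemireg's structure back for repair. A
published refutation of Markman Conj. 7.3.9 ∕ Perry Thm 1.1 outside abelian families does NOT kill
the route (the door is consumed on abelian pencils only) but forces the binder to be re-typed
abelian-only. HC_AV proved elsewhere moots the road. FIRST DISPROOF-STYLE ENTRY (vhodge-p4 g8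
THEOREM g8, kit j246432; director A2): on a pencil inside a Weil-type PEL family with a
general-Weil-type fibre, any UNTWISTED locally free witness is NOT semi-homogeneous — ⊕ line
bundles, π_*L, unipotent twists are dead for every I and rank (entry for the special case 19779; for
#2 it says the twist ∕ reflexive non-locally-free locus is where the room is).

NOT DECOMPOSED YET. The registered decomposition of #2 is the CELL SPLIT above ((4,2) · (6,3) ·
tail); no anchor-type or object-class split of a cell is filed; no split of K-C (one construction).
The named inputs (ranks 5–7 and the door binder rank 8; crux-kind only by the gate rule
`glue.non-crux-hypothesis`; never staffed) stay hypotheses (Literature seats own their discharge).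
The redirect node `AbelianSchemeVHC` is not an item of this route. The asides (19274 parent twin
with its v4 skeleton, 19779 ∕ 19170 untwisted special case, 19781 BF door) are outside the cone of
`closes` by design (bc6: 6 binders all consumed ∕ 4 asides ∕ Assembly exempt ∕ unaccounted 0 on rev
14). LABELS of record (J round 2 ∕ PART Y): tail stub = LEAF-CRITICAL; (4,2) ∕ (6,3) = MECHANISM
rungs (crux-load-bearing, leaf-idle); repair (β′) residual-free, (γ′) withdrawn; leaf-minimality is
not a tribunal axis (leaf-sufficient forms are exactly the cofinal ones). CARRIER CLASS (memo
ROUTE-P4-g8 §5 T3): the admissible carriers in print are Markman's secant sheaves (μ_r-twisted,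
reflexive, rank r ≠ 0, κ = ch·exp(−c₁/r)); the first research targets are their existence on
abelian-FOURFOLD pencils (cell (4,2)) and on NON-SPLIT sixfold pencils (cell (6,3)).

CHEAPEST FALSIFIER. The first cell (4,2) at a split CM anchor E⁴ on a generic-NS-rank-1 Weil-type
fourfold pencil: there the fibre condition is EXACTLY «an AdmTw-admissible twisted datum ℱ with
κ₂(ℱ) = a·W|s + c·Θ², a ≠ 0, jointly σ-injective» against J's budget 28 (next cells: 495 at (6,3),
8008 at (8,4)); Markman's dimension counts ([M] §8, `SecantSheafExtTwoGrowth`,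
`SpinorSecantDimensionCounts` in the tree's Markman2025 transcription) bound dim Ext²(ℱ,ℱ); a count
showing joint σ-injectivity CANNOT hold for any admissible twisted datum with exceptional κ₂ on E⁴
(or on a generic NS-rank-1 Weil-type fourfold) refutes the (4,2) cell — informative either way and
cost-free for the leaf ((β′)); the same count at (6,3) on E⁶ ∕ a generic non-split sixfold
(obstruction target C(6,4)·C(6,2) = 225 directions for σ₂) confines the rung to split components.
Lookups run for the rev-13 edit: BC2 ∕ BC4 ∕ BC7 of #2 BY NAME over the landed definitions (pre-read
folder `d0059-g149/b02-alpha/bc/`, verdicts CLEAN ×3; stub probes 9 ∕ 9 FAIL; converse not landed),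
replica elaboration, tribunal kernel `--full` on the born rev 14 (J, post-p471881: tk=PROVISIONAL).

NUMBERS. I-semiregularity on an abelian n-fold: obstruction space must inject into ⊕_(q∈I)
H^(q+1)(Ω^(q-1)), of dimension Σ_q C(n,q+1)·C(n,q-1); at
n = 4, q = 2: 16 directions; at n = 6, q = 3: C(6,4)·C(6,2) = 225. Weil fibres: (4; 2,2) and (6;
3,3), K imaginary quadratic, Weil classes in H^4 /
H^6; split ⟺ disc ∈ (−1)ⁿ·Nm(K^×) (Markman [S] `SplitIffDiscSignCoset`).

DEFINITION REQUESTS. LANDED (rev 5): defn-twistedReflexiveClass (p418024 (ACCEPTED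
2026-08-26T02:38:20Z, commit 1d9df456cc9a),
`Literature.AlgebraicGeometry.HodgeTheory.twistedReflexiveClass`), defn-TwistedPerfectDoorVHC
(p418024 (ACCEPTED 2026-08-26T02:38:20Z, commit 1d9df456cc9a),
`Literature.AlgebraicGeometry.HodgeTheory.TwistedPerfectDoorVHC`), defn-IsSemiHomogeneous (p418356
(ACCEPTED 2026-08-26T02:50:18Z, commit c54a77b7dfd6); for support T2 of the special case). Of the
gate: HC_AV as the alternative closer (D-0061, H1,
`--closes-target`, unchanged).

Novelty: Searches (2026-08-25): tree — `grep` over Theorems/Ring2*.lean, Summits/Ventures/HSemireg/*.lean,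
Cruxes/*/Lines/*.lean for `AdmissibleRepresentatives`,
`SemiregularSheafRepresentatives(Lef|LefAt)`, `AdmissibleRepresentativesLef(At)`,
`divisorClassesSpan`, `ChernCharacterOnBetti`, `LocalVariationalHodgeFor`,
`HC_AV_iff_abelianSchemeVHC_of_andre1996` (hits: Ring2DeformCompactPencils :189,
Literature/Barriers/HodgeConjecture/ExceptionalHodgeClasses.lean,
HSemireg AmplificationChainAssembly,
Cruxes/HodgeSimilitudeAlgebraic/Lines/semiregular-twin-hecke-vhc.lean stub_ChernCharacterOnBetti);
`ledger negatives
--problem HodgeConjecture` (6 entries, none related); literature placement by the dossier cell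
(vhodge/memos/ROUTE-P4-g5.md, ROUTE-P4-g6.md; lit §95–§97).
Nearest prior art found: key:BuchweitzFlenner2003 Thm. 5.1 (semiregular sheaves deform with their
Hodge classes), key:Bloch1972Semiregularity Rem. (7.5)
(the `a·z0 + b·l0^p` form), Grothendieck1966 footnote 13; in the tree: hsemireg's H2 line
`semiregular-twin-hecke-vhc` (same K-C stub, Weil-sixfold
scope), v1 of this brief (Deligne-1982 closer with the R3anc residual) and v2.1 (crux K-SR, vacuous
given `AbelianSchemeVHC` — vhodge-p4 g7's
kernel certificate 9615c188cefad2ff; memos ROUTE-P4-g7.md 3da0aeca9117e620, ROUTE-P4-g7-KSRflat.lean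
a8d0c37cba0b05bb).
Delta: the road asks for semiregular SHEAF carriers of arbitrary fibrewise-Hodge classes on abelian
pencils in Bloch's literal form — scalar multiple plus a fibrewise LEFS  [refs: key:BuchweitzFlenner2003, key:Bloch1972Semiregularity, BuchweitzFlenner2003, Grothendieck1966]

Barriers (technique_class: variational-hodge, semiregularity, deformation-of-sheaves): - technique_class: variational-hodge, semiregularity, deformation-of-sheaves. Placement against the
summit's barrier FILES that carry no catalogued gate key (named here because they are the ones that
bite this class): `Literature/Barriers/HodgeConjecture/ExceptionalHodgeClasses.lean`
(`Weil1977_exceptionalHodgeClasses`, `Mumford1968_simpleFourfold_exceptionalHodgeClasses`) — OUTSIDE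
its technique class (divisor classes ∕ Lefschetz (1,1) ∕ cup products): the Lefschetz part of W is
exactly what the correction Z absorbs, and by carrier-v2 §3∕§5 (`lefschetz_of_lefschetzCarrier`,
`weilFourfold_defeats_lefschetzCarriers`, from that file's own fact) the crux has content ONLY
through a carrier with EXCEPTIONAL ch_p — the barrier is what makes K-SR♭∃ non-vacuous and why it
might fail at Weil fibres, not a theorem against it; `KaehlerCoherentSheaves.lean`
(`Voisin2002_weilTorus_hodgeClassWithoutSubvarieties`; the tribunal CLI's t4 match) — outside: the
fibres are projective abelian varieties, where the barrier's hypothesis (a general Weil TORUS with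
no non-zero integral (1,1) class) fails; it warns only that the carrier cannot come from
torus-generic constructions; `CMHodgeRingNotGeneratedInCodimensionTwo.lean` (Hazama) — outside: no
low-codimension generation claim, I ranges over all degrees; it bears on the CHOICE of fibre in
K-SR♭∃ (at a simple CM fibre W| may itself be exceptional, so the Lefschetz correction buys nothing
there; the split fibre Eⁿ evades it); `AbsoluteHodgeClasses.

History (route lifecycle, newest last):
- 2026-08-26T09:17:30Z · rev 12: restated Assembly (stmt-HodgeConjecture-19785) — bookkeeping (tribunal J note rev 10 (b), LOW): Assembly item 19785 restated 1:1 to the twin chain that closes consumes (TwAt + TwistedPerfectDoor) instead of th (planner-pub-hodge-ring2-typer1-g145-0)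

sub-problem: HodgeConjecture · status: open · opened planner-pub-hodge-ring2-typer1-g143-0 2026-08-25T22:18:02Z · rev 27 · ledger route-HodgeConjecture-VHCAbelianSchemesRoad
GENERATED by the gate from the ledger (D-0016/17). Provers cite these decls: `theorem foo : Summit.HodgeConjecture.HodgeConjecture.Theses.VHCAbelianSchemesRoad.<Decl> := …` in Summits/HodgeConjecture/HodgeConjecture/Theorems/<Name>.lean.
-/

namespace Summit.HodgeConjecture.HodgeConjecture.Theses.VHCAbelianSchemesRoad

open scoped BigOperators Topology Manifold Classical MeasureTheory ProbabilityTheory Matrix InnerProductSpace ComplexConjugate ContinuousMap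
open Filter Set Function TopologicalSpace MeasureTheory

attribute [summit_statement] _root_.HodgeConjecture
attribute [summit_statement] _root_.Summit.HodgeConjecture.HodgeConjecture.Theses.PadicSemiregularLift.HodgeAbelianVarieties

open Literature.AlgebraicGeometry.HodgeTheory Summit.Ventures.HSemireg

/-- item stmt-HodgeConjecture-23176 · crux · rank 2 · SPLIT (gen 1) into MarkmanPinnedForallTwPrime, DiagLocalOfMarkmanPinnedForall + glue SemiregularSheafRepresentativesTwPrimeAtDiagLocalGlue · direct attempts still welcome (low priority) · by planner
why it might fail: (4,2): ONE admissible carrier on a fourfold pencil (or pointwise), none in print (Markman Cor 1.6.1: by degeneration only); (6,3): ≥ 2 independent carried directions per pinned anchor, the mover owing L1″ (Bloch kernel ⟺ hyperelliptic); print carrier split-Weil only, preprint; m ≥ 4: no object.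
sources: Markman2025SecantWeil, Markman2025SurveySecant, Pridham2024Semiregularity, BuchweitzFlenner2003, Bloch1972Semiregularity, vanGeemen1994HodgeAV
[crux] LOCAL-IN-THE-FIBRE (SPAN) twin of items stmt-HodgeConjecture-20707
`SemiregularSheafRepresentativesTwPrimeAtDiag` (single datum) and stmt-HodgeConjecture-23112
`…TwPrimeAtDiagAdd` (additive) — director-hodge g11 RULING R11.4 + DECISION (INBOX l.5400/l.5406,
2026-08-27) on ab-andre-2 g66's SPAN CAVEAT (l.5399: in the additive form every carried class must
extend to a GLOBAL fibrewise-Hodge class of THE GIVEN pencil; on a Weil-cell pencil whose monodromy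
only NORMALISES K the global sections of W_K are one line and span buys nothing there) and g66's
kernel files `Theorems/VHCAbelianSchemesRoadLocusEngine.lean` (p580105) +
`Theorems/VHCAbelianSchemesRoadRegimeLocal.lean` (p580192), `--supports 20707`: K-SR♭∃ over the
PRIMED twisted door `tw(C, AdmTw′)`, AdmTw′ := `fun n X₀ I E => gluableSigmaAdmissible n X₀ I E ∨
bfSingleAdmissible' n X₀ I E` (UNCHANGED since rev 18), DIAGONAL SLICE m ≥ 2, LOCAL FORM
`Ring2.SemiregularRepresentatives.LefAtExceptionalRegimeAtLocal 𝒪 (2m) m`: binders of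
`LefAtExceptionalRegimeAt` VERBATIM (one-parameter abelian scheme f of relative dimension 2m over a
smooth irreducible affine curve with a section, quasi-projective total space; W fibrewise ration -/
@[route_item "route-HodgeConjecture-VHCAbelianSchemesRoad", crux]
def SemiregularSheafRepresentativesTwPrimeAtDiagLocal : Prop :=
  ∀ (C : Literature.AlgebraicGeometry.HodgeTheory.ChernCharacterBetti) (m : ℕ), 2 ≤ m → Summit.HodgeConjecture.HodgeConjecture.Ring2.SemiregularRepresentatives.LefAtExceptionalRegimeAtLocal (Literature.AlgebraicGeometry.HodgeTheory.twistedReflexiveClass C (fun n X₀ I E => Summit.Ventures.HSemireg.gluableSigmaAdmissible n X₀ I E ∨ Literature.AlgebraicGeometry.HodgeTheory.bfSingleAdmissible' n X₀ I E)) (2 * m) m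

-- parent: SemiregularSheafRepresentativesTwPrimeAtDiagLocal · child (gen 1)
/--     item stmt-HodgeConjecture-26511 · crux · rank 201 · open
    parent: SemiregularSheafRepresentativesTwPrimeAtDiagLocal · by planner
    why it might fail: The preprint is unrefereed (L1″: 𝓔̄'s AdmTw′-admissibility holds on paper only, THEOREM T ×2 with O₁); with H_disj displayed the ∀-reading is print-faithful per WAKE #8, but H_disj's independence is argued not proved and the conclusion side rests on WAKEs #1–#7's reading of Thm 1.4.1 item 4.
    sources: Markman2025SecantWeil, arXiv:2502.03415
[crux — DISPLAYED CONDITIONAL PRINT INPUT, never staffed; director-hodge g12 R12.6 (α),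
refute-markman WAKE #8 GENERIC-ONLY: H_disj = `OrbitTranslatesDisjoint` (memo
`REFUTE-MARKMAN-G11-W8.md` sha256∕16 2304c1596b6083b0, evidence #16 on 23176)] L1″_∀(C, AdmTw′) for
every Chern-character theory C: Markman's pinned secant–quotient carrier claim (arXiv:2502.03415,
PREPRINT under review; Thm. 1.4.1 item 4 ∕ Thm. 1.5.1 ∕ §9) READ IN ∀-FORM over NON-hyperelliptic
genus-3 secant–quotient data in general position WHOSE G₁- AND G₂-ORBIT TRANSLATES OF THE
ABEL–JACOBI CURVE ARE PAIRWISE DISJOINT (print's standing hypothesis H_disj of §9.1 p. 57, generic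
by Lemma 9.1.4, displayed INSIDE the def as the binder `OrbitTranslatesDisjoint 𝒥 G₁ G₂` after `¬
𝒥.IsHyperelliptic` — «print's claim holds for data satisfying H» (refute-markman WAKE #8
2304c1596b6083b0); Assumptions 9.1.1 ∕ 9.2.1 then hold at every such datum), with the pin
prescribed, stated BY THE LITERATURE NAME
`Markman2025_secantQuotient_twistedCarrier_onJacobian_pinnedForall` (a claim-fact `def … : Prop` in
hypothesis form, module
`Literature/AlgebraicGeometry/HodgeTheory/SecantQuotientJacobianTwistedCarrierForall.lean` p609889;
nothin -/
@[route_item "route-HodgeConjecture-VHCAbelianSchemesRoad"]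
def MarkmanPinnedForallTwPrime : Prop :=
  ∀ C : Literature.AlgebraicGeometry.HodgeTheory.ChernCharacterBetti, Literature.AlgebraicGeometry.HodgeTheory.Markman2025_secantQuotient_twistedCarrier_onJacobian_pinnedForall C (fun n X₀ I E => Summit.Ventures.HSemireg.gluableSigmaAdmissible n X₀ I E ∨ Literature.AlgebraicGeometry.HodgeTheory.bfSingleAdmissible' n X₀ I E)

-- parent: SemiregularSheafRepresentativesTwPrimeAtDiagLocal · child (gen 1)
/--     item stmt-HodgeConjecture-26512 · crux · rank 202 · open
    parent: SemiregularSheafRepresentativesTwPrimeAtDiagLocal · by planner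
    why it might fail: The four stubs: no carrier known for the (4,2) cell or the tail; the mover's span clause presumes rk 𝔖^pin = 2 mod θ³ at every H-good off-hyperelliptic datum (O₁'s special set undecided); the residual pairs (even d ≥ 6, non-Weil exceptional classes, unreachable fibres) have no object at all.
    sources: Markman2025SecantWeil, BuchweitzFlenner2003, Bloch1972Semiregularity, Andre1996Motifs
[crux — THE LIVE DECIDING CRUX after R12.6 (α)] the LOCAL-IN-THE-FIBRE diagonal slice m ≥ 2 over the
primed twisted door (item stmt-HodgeConjecture-23176
`SemiregularSheafRepresentativesTwPrimeAtDiagLocal`, verbatim) CONDITIONAL on the displayed print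
input `MarkmanPinnedForallTwPrime` (L1″_∀ at AdmTw′ for data satisfying print's standing hypothesis
`OrbitTranslatesDisjoint` — refute-markman WAKE #8 GENERIC-ONLY: H_disj, 2304c1596b6083b0 — by the
Literature name): everything of 23176 EXCEPT Markman's own claim. Skeleton v3.8
(`Cruxes/DiagLocalOfMarkmanPinnedForall/Lines/birth.lean`, FOUR registered stubs: 1′
`stub_firstCell_fourfoldMiddleTwPrime` (4,2) XL · 2m′ᵒᴴ
`stub_secondCarried_63_secantQuotientPinnedOffHypDisjPrime` = the by-name mover at pinned anchors
presented by non-hyperelliptic H-good data (v3.7's 2m′ᵒ re-domained to H-good presentations, WAKE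
#8) = T3 PLAN-ONLY designate (HOLDS on paper at d = 4, THEOREM T ×2 with O₁; typing-bound) · 2r′ᵒᴴ
`stub_localResidualPairs_63_OffHypDisjTwPrime` XL (residual pairs = not reachable from an H-good
off-hyperelliptic-presented anchor; H-bad locus proper closed in each level family, print Lemma
9.1.4 — D1b's density-only consumer unaf -/
@[route_item "route-HodgeConjecture-VHCAbelianSchemesRoad"]
def DiagLocalOfMarkmanPinnedForall : Prop :=
  (∀ C : Literature.AlgebraicGeometry.HodgeTheory.ChernCharacterBetti, Literature.AlgebraicGeometry.HodgeTheory.Markman2025_secantQuotient_twistedCarrier_onJacobian_pinnedForall C (fun n X₀ I E => Summit.Ventures.HSemireg.gluableSigmaAdmissible n X₀ I E ∨ Literature.AlgebraicGeometry.HodgeTheory.bfSingleAdmissible' n X₀ I E)) → Summit.HodgeConjecture.HodgeConjecture.Theses.VHCAbelianSchemesRoad.SemiregularSheafRepresentativesTwPrimeAtDiagLocal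

-- parent: SemiregularSheafRepresentativesTwPrimeAtDiagLocal · glue (gen 1)
/--     item stmt-HodgeConjecture-26513 · support · rank 203 · open
    parent: SemiregularSheafRepresentativesTwPrimeAtDiagLocal · GLUE: children ⟹ parent · by planner
modus ponens: MarkmanPinnedForallTwPrime → (MarkmanPinnedForallTwPrime →
SemiregularSheafRepresentativesTwPrimeAtDiagLocal) →
SemiregularSheafRepresentativesTwPrimeAtDiagLocal — the first child is the DISPLAYED CONDITIONAL
PRINT INPUT (never staffed), the second the live crux; director-hodge g12 R12.6 (α) -/
@[route_item "route-HodgeConjecture-VHCAbelianSchemesRoad"]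
def SemiregularSheafRepresentativesTwPrimeAtDiagLocalGlue : Prop :=
  MarkmanPinnedForallTwPrime → DiagLocalOfMarkmanPinnedForall → SemiregularSheafRepresentativesTwPrimeAtDiagLocal

/-- item stmt-HodgeConjecture-19780 · crux · rank 3 · open · by planner
why it might fail: only as TYPED — the structure's laws quantify over all SchemeOver ℂ and all modules and could be jointly unsatisfiable as stated (hsemireg's rescaling audit found no inconsistency, but no model is built).
sources: Fulton1998, VoisinHodgeI2002
[crux] K-C (construction): a Chern character theory on complex Betti cohomology satisfying Fulton's
laws exists — an instance of hsemireg's structure `ChernCharacterBetti` (intended: cl ∘ ch).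
Load-bearing because the sheaf door and K-SR♭∃ are parametrised by C; the tree deliberately has no
existence theorem for the structure. [difficulty: L] -/
@[route_item "route-HodgeConjecture-VHCAbelianSchemesRoad", crux]
def ChernCharacterOnBetti : Prop :=
  Summit.HodgeConjecture.HodgeConjecture.Ring2.SemiregularRepresentatives.ChernCharacterOnBetti

/-- item stmt-HodgeConjecture-19782 · crux · rank 5 · open · by planner
why it might fail: only by mis-rendering — Raynaud 1970 Thm. XI 1.4 needs a normal base; the Lean fact quantifies over the tree's `AbelianSchemeOver` with section, whose base hypotheses must match.
sources: GortzWedhorn2023, Raynaud1970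
[crux] REFEREED NAMED FACT — Literature input, not a research target, never staffed (crux-kind per
the measured gate rule); by name (Raynaud 1970: an abelian scheme with a section over a normal base
is projective), giving ring 2's curve residual
`Ring2.Binders.OneParameterAbelianSchemeQuasiProjective` by the tree theorem
`oneParameterAbelianSchemeQuasiProjective_of_raynaud1970`. [difficulty: provable-now] -/
@[route_item "route-HodgeConjecture-VHCAbelianSchemesRoad", crux]
def RaynaudSectionProjective : Prop :=
  Literature.AlgebraicGeometry.Motives.raynaud1970_abelianScheme_section_projective

/-- item stmt-HodgeConjecture-19783 · crux · rank 6 · open · by planner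
why it might fail: only by mis-rendering — Lemme 6.3.1 produces a compact pencil through a CM point inside a Mumford–Tate family; the Lean fact's «compact, CM-anchored, one-parameter» data must be exactly what `HC_AV_iff_abelianSchemeVHC_of_andre1996` consumes (it is, by that theorem's type).
sources: Andre1996Motifs
[crux] REFEREED NAMED FACT — Literature input, not a research target, never staffed (crux-kind per
the measured gate rule); by name (André 1996 Lemme 6.3.1): every Hodge class on a complex abelian
variety sits on a compact CM-anchored pencil. [difficulty: provable-now] -/
@[route_item "route-HodgeConjecture-VHCAbelianSchemesRoad", crux]
def AndreCMAnchoredPencil : Prop :=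
  Literature.AlgebraicGeometry.Andre1996.andre1996_cmAnchoredPencil

/-- item stmt-HodgeConjecture-19784 · crux · rank 7 · SPLIT (gen 1) into AndreSplitWeilPencilsAnchored, KodairaHyperplaneClass + glue Summit.HodgeConjecture.HodgeConjecture.Theorems.AndreKodairaGlue.andreAnchoredPencilsAlgebraic_of_splitWeilPencil_of_kodaira_routeFree · direct attempts still welcome (low priority) · by planner
why it might fail: only by mis-rendering — Lemmes 6.3.2–6.3.3 use HC for CM abelian varieties of the pencil's CM fibre only through André's motivated-cycle argument; if the Lean fact silently packages HC_CM it is stronger than print (Literature seat to confirm the docstring's scope).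
sources: Andre1996Motifs
[crux] REFEREED NAMED FACT — Literature input, not a research target, never staffed (crux-kind per
the measured gate rule); by name (André 1996 Lemmes 6.3.2–6.3.3): the CM fibre's Hodge classes of
such a pencil are algebraically anchored. [difficulty: provable-now] -/
@[route_item "route-HodgeConjecture-VHCAbelianSchemesRoad", crux]
def AndreAnchoredPencilsAlgebraic : Prop :=
  Literature.AlgebraicGeometry.Andre1996.andre1996_cmHodgeClasses_algebraicallyAnchoredPencils

-- parent: AndreAnchoredPencilsAlgebraic · child (gen 1)
/--     item stmt-HodgeConjecture-20271 · crux · rank 701 · open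
    parent: AndreAnchoredPencilsAlgebraic · by planner
    why it might fail: Rendering risk only: the typed fact serves a FINITE family of (B_j, w_j) by ONE pencil, for every split E-compatible hyperplane polarisation; if p. 33's one Mumford family does not serve an arbitrary finite family at once, the ∀-finite-family clause is stronger than print (André 1996, 6.3.3).
    sources: Andre1996Motifs
[crux-kind cite-level binder, never staffed (same convention as the parent binder #22); research
route conditional on HC_CM; not a corollary; Q11.4-sentence-2 already refuted in dim ≥ 3] André 1996
Lemme 6.3.3 ALONE (Publ. IHES 83, p. 33, with §6.3 b) condition (*), p. 32): for a CM field E of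
degree 2e₀, an integer p > 1 and finitely many abelian varieties B_j of Weil type relative to E with
dim_E H¹ = 2p, each polarised by an E-compatible HYPERPLANE CLASS h_j = e_j^* a_j for which the Weil
structure is SPLIT (a rational E-stable Lagrangian half; Deligne Cor. 4.2 (b)), and rational Weil
classes w_j ∈ (⋀^{2p}_E H¹(B_j))(p), there is ONE compact pencil of abelian varieties algebraically
anchored for every (B_j, w_j) (`IsAlgebraicallyAnchoredPencilFor`: a fibre isogenous to B_j through
which w_j extends to a global section of rational (p,p) classes, and a fibre where the section is
algebraic — in print a power of an elliptic curve, Tate–Murasaki). NO CM hypothesis on the B_j;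
weaker than print. This is the research-level residue of the parent binder
`AndreAnchoredPencilsAlgebraic` (= Lemmes 6.3.2–6.3.3 jointly): the Lemme 6.3.2 half is DISCHARGED
in the kernel by COR-CM's hypothesis- -/
@[route_item "route-HodgeConjecture-VHCAbelianSchemesRoad", crux]
def AndreSplitWeilPencilsAnchored : Prop :=
  Literature.AlgebraicGeometry.Andre1996.andre1996_splitWeilClasses_algebraicallyAnchoredPencil

-- parent: AndreAnchoredPencilsAlgebraic · child (gen 1)
/--     item stmt-HodgeConjecture-20272 · support · rank 702 · open
    parent: AndreAnchoredPencilsAlgebraic · by planner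
    sources: Huybrechts2005, VoisinHodgeI2002
[support · cite-level NAMED FACT, textbook, never staffed; research route conditional on HC_CM; not
a corollary; Q11.4-sentence-2 already refuted in dim ≥ 3] Kodaira's embedding theorem in
cohomological form: on a smooth projective complex variety of dimension ≥ 1, a RATIONAL class h ∈
H²(X(ℂ); ℂ) a non-zero real multiple of which is Kähler equals e^* a for a projective embedding e :
X ↪ ℙʳ and a non-zero rational class a (Kodaira 1954 via Huybrechts Prop. 5.3.1 / Cor. 5.3.3 and
Voisin I Thm. 7.10–7.11, 7.14, with Lefschetz (1,1) and Chow–Serre). Statement-only Literature file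
`HodgeTheory/KodairaEmbeddingHyperplaneClass.lean` (andre-pencil-p1, p527661, reviewed «faithful
rendering; weaker than print»). It converts the Kähler-multiple polarisation vocabulary of COR-CM's
proved André-1992 theorem into the hyperplane-class vocabulary of Lemme 6.3.3 as typed; first
hypothesis of the landed glue `Theorems.AndreAnchoredPencilsAlgebraic_of_kodaira_of_splitWeilPencil`
(p529100). -/
@[route_item "route-HodgeConjecture-VHCAbelianSchemesRoad", crux]
def KodairaHyperplaneClass : Prop :=
  Literature.AlgebraicGeometry.HodgeTheory.Kodaira1954_rationalKaehlerClass_eq_hyperplaneClass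

/-- glue for the split of `AndreAnchoredPencilsAlgebraic`: landed theorem `Summit.HodgeConjecture.HodgeConjecture.Theorems.AndreKodairaGlue.andreAnchoredPencilsAlgebraic_of_splitWeilPencil_of_kodaira_routeFree`. -/
theorem AndreAnchoredPencilsAlgebraicGlueBy_holds : AndreSplitWeilPencilsAnchored → KodairaHyperplaneClass → AndreAnchoredPencilsAlgebraic := _root_.Summit.HodgeConjecture.HodgeConjecture.Theorems.AndreKodairaGlue.andreAnchoredPencilsAlgebraic_of_splitWeilPencil_of_kodaira_routeFree

/-- item stmt-HodgeConjecture-20706 · crux · rank 8 · open · by planner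
why it might fail: σ-disjunct preprint-sourced as a GLOBAL statement (Markman Conj. 7.3.9 = conjecture outside abelian families; Perry Thm 1.1 unrefereed); typed risk: the tree's semiregularity map for twisted perfect complexes vs Pridham's 𝓛; the BF′ disjunct is refereed (BF Thm 5.1 + unipotent transform).
sources: Pridham2024Semiregularity, Markman2025SecantWeil, Perry2026Semiregularity, BuchweitzFlenner2003
[crux-kind binder; NAMED INPUT, never staffed — crux-kind only by the gate rule
`glue.non-crux-hypothesis`] PRIMED twin of item stmt-HodgeConjecture-19275 `TwistedPerfectDoor`
(door-slice audit repair 1, ab-andre-2 g60 DOOR-SLICE-AUDIT-g60.md d8fc261a885387a8; director-hodge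
R9.1/R9.3; LEAD 157 DOOR-PRIME-PACKAGE.md): the local variational Hodge statement
`Literature.AlgebraicGeometry.HodgeTheory.TwistedPerfectDoorVHC C AdmTw'` for the twisted object
class `twistedReflexiveClass C AdmTw'`, with the NARROWER admissibility AdmTw' := `fun n X₀ I E =>
Summit.Ventures.HSemireg.gluableSigmaAdmissible n X₀ I E ∨
Literature.AlgebraicGeometry.HodgeTheory.bfSingleAdmissible' n X₀ I E` (`bfSingleAdmissible' :=
bfSingleAdmissible ∧ I.IsShiftedInitialSegment`, Literature p537197
`TwistedPerfectAdmissibilityInitialSegment.lean`): in a smooth projective family over a smooth base,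
an AdmTw'-admissible twisted datum (semiregular μ_r-twisted perfect complex with B-field B₀ /
Buchweitz–Flenner I-semiregular vector bundle on a SHIFTED-INITIAL-SEGMENT index set I) at one fibre
whose flat transports stay Hodge has algebraic classes at every nearby fibre. WHY PRIMED: the
unprimed binder quantifies over t -/
@[route_item "route-HodgeConjecture-VHCAbelianSchemesRoad", crux]
def TwistedPerfectDoorPrime : Prop :=
  ∀ C : Literature.AlgebraicGeometry.HodgeTheory.ChernCharacterBetti, Literature.AlgebraicGeometry.HodgeTheory.TwistedPerfectDoorVHC C (fun n X₀ I E => Summit.Ventures.HSemireg.gluableSigmaAdmissible n X₀ I E ∨ Literature.AlgebraicGeometry.HodgeTheory.bfSingleAdmissible' n X₀ I E)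

/-- item stmt-HodgeConjecture-19274 · aside · rank 2 · open · by planner
why it might fail: flatness pins Z ≡ c·Θᵖ on NS-rank-1 Weil pencils, so a carrier needs κ_p = a·W|s + c·θᵖ exactly AND semiregularity; in print only Markman's twisted secant carrier on SPLIT Weil-SIXFOLD pencils (2502.03415 Thm 1.5.1, preprint); fourfold pencils: none; non-split sixfolds: none; Q11.4-s2 dead, dim ≥ 3.
sources: Markman2025SecantWeil, Markman2025SurveySecant, Pridham2024Semiregularity, BuchweitzFlenner2003, Bloch1972Semiregularity, vanGeemen1994HodgeAV
[crux] K-SR♭∃ over the TWISTED door (ruling A1, director-hodge 2026-08-25T22:39:44Z / 23:06:02Z;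
vhodge-p4 g8 memo ROUTE-P4-g8.md §4): for every Chern character theory C, on every one-parameter
abelian scheme over a smooth irreducible affine curve with a section, for every fibrewise rational
(p,p) global class W algebraic on one fibre, SOME fibre carries a
`Literature.AlgebraicGeometry.HodgeTheory.twistedReflexiveClass C AdmTw`-admissible datum (a
semiregular μ_r-twisted reflexive sheaf / twisted perfect complex with B-field, in the sense of the
landed definition defn-twistedReflexiveClass p418024 (ACCEPTED 2026-08-26T02:38:20Z, commit
1d9df456cc9a), admissibility notion AdmTw := `fun n X₀ I E =>
Summit.Ventures.HSemireg.gluableSigmaAdmissible n X₀ I E ∨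
Literature.AlgebraicGeometry.HodgeTheory.bfSingleAdmissible n X₀ I E` (the venture's gluable
σ-semiregularity for strictly perfect complexes — {1..n} ⊆ I, Ext^{<0} = 0, (σ_q)_{q+1∈I} jointly
injective on Ext² — OR Buchweitz–Flenner I-semiregularity of a single vector bundle in degree 0;
option (b) of ring2-b02 gen 74, chosen so that the untwisted class embeds: bfSheafClass C ≤
twistedReflexiveClass C AdmTw)) whose degree-p class is -/
@[route_item "route-HodgeConjecture-VHCAbelianSchemesRoad"]
def SemiregularSheafRepresentativesTwAt : Prop :=
  ∀ C : Literature.AlgebraicGeometry.HodgeTheory.ChernCharacterBetti, Summit.HodgeConjecture.HodgeConjecture.Ring2.SemiregularRepresentatives.AdmissibleRepresentativesLefAt (Literature.AlgebraicGeometry.HodgeTheory.twistedReflexiveClass C (fun n X₀ I E => Summit.Ventures.HSemireg.gluableSigmaAdmissible n X₀ I E ∨ Literature.AlgebraicGeometry.HodgeTheory.bfSingleAdmissible n X₀ I E))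

/-- item stmt-HodgeConjecture-19779 · aside · rank 2 · open · by planner
why it might fail: flatness pins the Lefschetz correction to c·Θᵖ on NS-rank-1 pencils, so the carrier needs ch_p = a·W|s + c·θᵖ exactly AND I-semiregularity; at split anchors Eⁿ a line-bundle design problem (r ≤ 2 summands at n=4, p=2): hsemireg: 0/218 semiregular designs at g = 6; no untwisted carrier in print (A1).
sources: BuchweitzFlenner2003, Bloch1972Semiregularity, vanGeemen1994HodgeAV, Grothendieck1966, Andre1996Motifs
[crux] K-SR♭∃ (vhodge-p4 g7, Bloch 1972 Rem. (7.5) literally, ∃-fibre form): for every Chern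
character theory C, on every one-parameter abelian scheme over a smooth irreducible affine curve
with a section, for every fibrewise rational (p,p) global class W algebraic on one fibre, SOME fibre
carries a finite locally free I-semiregular sheaf (p ∈ I) whose ch_p is a·W| + Z| with a ≠ 0 and Z a
global class that is an algebraic LEFSCHETZ class (in `divisorClassesSpan`, the span of p-fold
products of rational (1,1)-classes) on EVERY fibre, and whose ch_q (q ∈ I) are restrictions of
fibrewise (q,q) global classes. [deps: ChernCharacterOnBetti] [difficulty: open-problem] -/
@[route_item "route-HodgeConjecture-VHCAbelianSchemesRoad"]
def SemiregularSheafRepresentativesLefAt : Prop :=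
  Summit.HodgeConjecture.HodgeConjecture.Ring2.SemiregularRepresentatives.SemiregularSheafRepresentativesLefAt

/-- item stmt-HodgeConjecture-19787 · aside · rank 2 · open · by planner
why it might fail: (4,2): no semiregular carrier on an abelian-FOURFOLD pencil in print (Markman 2502.03415: fourfolds only by degeneration, Cor 1.6.1); print carrier only at (6,3) split-Weil (Thm 1.5.1, preprint); m ≥ 4: none; must be READ AT AdmTw′ for a print-exact door (R9.4) — the primed twin is STRONGER.
sources: Markman2025SecantWeil, BuchweitzFlenner2003, Bloch1972Semiregularity
[crux] K-SR♭∃ over the TWISTED door, DIAGONAL SLICE m ≥ 2 (option (α) = A′ of the PART X DIAGONAL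
CONFINEMENT, ab-andre-2 g55 p448719 / p450067, evidence DIAGONAL-CONFINEMENT.md caa11b29274da9d4;
tribunal J note j-note-rev12-diagonal.md 7fe23531f7920f4a §5 (α); director-hodge g4
2026-08-26T14:12:53Z leaning A′): for every Chern character theory C and every m ≥ 2, regime 2 of
K-SR♭∃ AT relative dimension 2m and codimension m
(`Summit.HodgeConjecture.HodgeConjecture.Ring2.SemiregularRepresentatives.LefAtExceptionalRegimeAt`,
landed p441761) for the door `Literature.AlgebraicGeometry.HodgeTheory.twistedReflexiveClass C
AdmTw` (defn p418024; AdmTw := `fun n X₀ I E => Summit.Ventures.HSemireg.gluableSigmaAdmissible n X₀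
I E ∨ Literature.AlgebraicGeometry.HodgeTheory.bfSingleAdmissible n X₀ I E`, as in items 19274 /
19275): on every one-parameter abelian scheme of relative dimension 2m over a smooth irreducible
affine curve with a section and quasi-projective total space, every fibrewise rational (m,m) global
class W that is algebraic on one fibre and not algebraic-Lefschetz on every fibre admits, at SOME
fibre, an AdmTw-admissible twisted datum (semiregular μ_r-twisted reflexive sheaf / -/
@[route_item "route-HodgeConjecture-VHCAbelianSchemesRoad"]
def SemiregularSheafRepresentativesTwAtDiag : Prop :=
  ∀ (C : Literature.AlgebraicGeometry.HodgeTheory.ChernCharacterBetti) (m : ℕ), 2 ≤ m → Summit.HodgeConjecture.HodgeConjecture.Ring2.SemiregularRepresentatives.LefAtExceptionalRegimeAt (Literature.AlgebraicGeometry.HodgeTheory.twistedReflexiveClass C (fun n X₀ I E => Summit.Ventures.HSemireg.gluableSigmaAdmissible n X₀ I E ∨ Literature.AlgebraicGeometry.HodgeTheory.bfSingleAdmissible n X₀ I E)) (2 * m) m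

/-- item stmt-HodgeConjecture-20707 · aside · rank 2 · open · by planner
why it might fail: (4,2): no semiregular carrier on an abelian-FOURFOLD pencil in print (Markman: fourfolds only by degeneration, Cor 1.6.1); AdmTw′ pins ALL lower classes of a BF-carrier to flat data on an initial segment (κ₂ ∈ ℂθ² at (6,3): new content); print carrier only at (6,3) split-Weil, preprint; m ≥ 4: none.
sources: Markman2025SecantWeil, Markman2025SurveySecant, Pridham2024Semiregularity, BuchweitzFlenner2003, Bloch1972Semiregularity, vanGeemen1994HodgeAV
[crux] PRIMED twin of item stmt-HodgeConjecture-19787 `SemiregularSheafRepresentativesTwAtDiag` (the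
route's rank-2 deciding crux; its evidence chain n°1–n°60, card
`Cruxes/SemiregularSheafRepresentativesTwAtDiag/Lines/birth.md` rev ≥ 15 and registered skeleton
v3.1 stay the record; skeleton v3.2 = the same cells read at AdmTw' is registered on THIS item —
LEAD 157 DOOR-PRIME-PACKAGE.md): K-SR♭∃ over the PRIMED twisted door, DIAGONAL SLICE m ≥ 2 — for
every Chern character theory C and every m ≥ 2, regime 2
`Summit.HodgeConjecture.HodgeConjecture.Ring2.SemiregularRepresentatives.LefAtExceptionalRegimeAt`
at relative dimension 2m and codimension m for the door `twistedReflexiveClass C AdmTw'`, AdmTw' :=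
`fun n X₀ I E => Summit.Ventures.HSemireg.gluableSigmaAdmissible n X₀ I E ∨
Literature.AlgebraicGeometry.HodgeTheory.bfSingleAdmissible' n X₀ I E` (`bfSingleAdmissible' :=
bfSingleAdmissible ∧ I.IsShiftedInitialSegment`, p537197): on every one-parameter abelian scheme of
relative dimension 2m over a smooth irreducible affine curve with a section and quasi-projective
total space, every fibrewise rational (m,m) global class W algebraic on one fibre and not
algebraic-Lefschetz on every -/
@[route_item "route-HodgeConjecture-VHCAbelianSchemesRoad"]
def SemiregularSheafRepresentativesTwPrimeAtDiag : Prop :=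
  ∀ (C : Literature.AlgebraicGeometry.HodgeTheory.ChernCharacterBetti) (m : ℕ), 2 ≤ m → Summit.HodgeConjecture.HodgeConjecture.Ring2.SemiregularRepresentatives.LefAtExceptionalRegimeAt (Literature.AlgebraicGeometry.HodgeTheory.twistedReflexiveClass C (fun n X₀ I E => Summit.Ventures.HSemireg.gluableSigmaAdmissible n X₀ I E ∨ Literature.AlgebraicGeometry.HodgeTheory.bfSingleAdmissible' n X₀ I E)) (2 * m) m

/-- item stmt-HodgeConjecture-23112 · aside · rank 2 · open · by planner
why it might fail: (4,2): ONE admissible carrier on a fourfold pencil, none in print (Markman Cor 1.6.1: by degeneration only); (6,3): the span needs ≥ 2 independent carried directions per pinned pencil, the mover owing L1″ (Bloch kernel ⟺ hyperelliptic); print carrier split-Weil only, preprint; m ≥ 4: no object.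
sources: Markman2025SecantWeil, Markman2025SurveySecant, Pridham2024Semiregularity, BuchweitzFlenner2003, Bloch1972Semiregularity, vanGeemen1994HodgeAV
[crux] ADDITIVE (SPAN) twin of item stmt-HodgeConjecture-20707
`SemiregularSheafRepresentativesTwPrimeAtDiag` (director-hodge g11 RULING R11.3 (1)/(3), 2026-08-27,
on LEAD 160's reading `DQ112-QALPHA-READING-g160.md` = evidence #49 on 20707, ×2 with certificate by
ab-andre-2 g66 `ADDITIVE-DOOR-g66.md` = #51; kernel files
`Theorems/VHCAbelianSchemesRoadRegimeAdditive.lean` + `…RegimeAdditiveKernel.lean`, ab-andre-2 g66,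
`--supports 20707`): K-SR♭∃ over the PRIMED twisted door `tw(C, AdmTw′)`, AdmTw′ := `fun n X₀ I E =>
Summit.Ventures.HSemireg.gluableSigmaAdmissible n X₀ I E ∨
Literature.AlgebraicGeometry.HodgeTheory.bfSingleAdmissible' n X₀ I E`, DIAGONAL SLICE m ≥ 2,
ADDITIVE FORM
`Summit.HodgeConjecture.HodgeConjecture.Ring2.SemiregularRepresentatives.LefAtExceptionalRegimeAtAdd
𝒪 (2m) m`: on every one-parameter abelian scheme of relative dimension 2m over a smooth irreducible
affine curve with a section and quasi-projective total space, every fibrewise rational (m,m) global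
class W algebraic on one fibre and not algebraic-Lefschetz on every fibre admits FINITELY MANY (0 <
k) AdmTw′-admissible twisted data — each at ITS OWN fibre s_i of the pencil, with its own pinned
degree set -/
@[route_item "route-HodgeConjecture-VHCAbelianSchemesRoad"]
def SemiregularSheafRepresentativesTwPrimeAtDiagAdd : Prop :=
  ∀ (C : Literature.AlgebraicGeometry.HodgeTheory.ChernCharacterBetti) (m : ℕ), 2 ≤ m → Summit.HodgeConjecture.HodgeConjecture.Ring2.SemiregularRepresentatives.LefAtExceptionalRegimeAtAdd (Literature.AlgebraicGeometry.HodgeTheory.twistedReflexiveClass C (fun n X₀ I E => Summit.Ventures.HSemireg.gluableSigmaAdmissible n X₀ I E ∨ Literature.AlgebraicGeometry.HodgeTheory.bfSingleAdmissible' n X₀ I E)) (2 * m) m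

/-- item stmt-HodgeConjecture-19781 · aside · rank 4 · open · by planner
why it might fail: only by mis-rendering — the `_model` form states Thm. 5.1 over the tree's model carriers (IsFiniteLocallyFree, semiregularity map, flat transport); a carrier mismatch, not the printed theorem, is the risk.
sources: BuchweitzFlenner2003
[crux] REFEREED NAMED FACT — Literature input, not a research target, never staffed (crux-KIND only
because every binder of `closes` must be crux-kind, measured gate rule `glue.non-crux-hypothesis`,
director-hodge «19:54:35Z»); by name (Buchweitz–Flenner 2003 Thm. 5.1, model form): the variational
Hodge conclusion for the Chern character components of an I-semiregular finite locally free sheaf on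
a fibre of a smooth projective family. A hypothesis `(hBF : …)`; never proved here. [difficulty:
provable-now] -/
@[route_item "route-HodgeConjecture-VHCAbelianSchemesRoad"]
def BuchweitzFlennerSheafDoor : Prop :=
  Literature.AlgebraicGeometry.HodgeTheory.BuchweitzFlenner2003_variationalHodge_ISemiregular_model

/-- item stmt-HodgeConjecture-19275 · aside · rank 8 · open · by planner
why it might fail: σ-disjunct preprint-sourced as a GLOBAL statement (Markman Conj. 7.3.9; Perry Thm 1.1 unrefereed); on the slice {bfSingle, B₀ ≠ 0, I = {p}} the unprimed door EXCEEDS print (door-slice audit ab-andre-2 g60): repair = primed twin TwistedPerfectDoorPrime (R9.4, pending the 7-crux cap count).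
sources: Pridham2024Semiregularity, Markman2025SecantWeil, Perry2026Semiregularity, BuchweitzFlenner2003
[crux-kind binder; NAMED INPUT, never staffed — crux-kind only by the gate rule
`glue.non-crux-hypothesis`] the local variational Hodge statement for the twisted object class
`Literature.AlgebraicGeometry.HodgeTheory.twistedReflexiveClass C AdmTw` BY NAME
(`Literature.AlgebraicGeometry.HodgeTheory.TwistedPerfectDoorVHC C AdmTw`, per-C named fact
`Literature.AlgebraicGeometry.HodgeTheory.TwistedPerfectDoorVHC C`, the route binder being its ∀-C
closure; definition item defn-TwistedPerfectDoorVHC p418024 (ACCEPTED 2026-08-26T02:38:20Z, commit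
1d9df456cc9a); AdmTw := `fun n X₀ I E => Summit.Ventures.HSemireg.gluableSigmaAdmissible n X₀ I E ∨
Literature.AlgebraicGeometry.HodgeTheory.bfSingleAdmissible n X₀ I E` (the venture's gluable
σ-semiregularity for strictly perfect complexes — {1..n} ⊆ I, Ext^{<0} = 0, (σ_q)_{q+1∈I} jointly
injective on Ext² — OR Buchweitz–Flenner I-semiregularity of a single vector bundle in degree 0;
option (b) of ring2-b02 gen 74, chosen so that the untwisted class embeds: bfSheafClass C ≤
twistedReflexiveClass C AdmTw)): in a smooth projective family over a smooth base, a
`Literature.AlgebraicGeometry.HodgeTheory.twistedReflexiveClass C AdmTw`-admissible tuple -/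
@[route_item "route-HodgeConjecture-VHCAbelianSchemesRoad", crux]
def TwistedPerfectDoor : Prop :=
  ∀ C : Literature.AlgebraicGeometry.HodgeTheory.ChernCharacterBetti, Literature.AlgebraicGeometry.HodgeTheory.TwistedPerfectDoorVHC C (fun n X₀ I E => Summit.Ventures.HSemireg.gluableSigmaAdmissible n X₀ I E ∨ Literature.AlgebraicGeometry.HodgeTheory.bfSingleAdmissible n X₀ I E)

/-- item stmt-HodgeConjecture-19170 · aside · rank 9 · open · by operator
sources: BuchweitzFlenner2003, Bloch1972semiregularity, Markman2025JEMS
[support] K-SR♭∃ by name, δ-unfolded from 19779 SemiregularSheafRepresentativesLefAt; same content,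
filed so the head constant is item-stated (#15c one rule); sources: BuchweitzFlenner2003
(semireg4.pdf) Thm 5.2/Cor 6.6, Bloch 1972 Inv. Math. 17 Thm 7.3, Markman 2025 JEMS Thm 1.5 -/
@[route_item "route-HodgeConjecture-VHCAbelianSchemesRoad"]
def AdmissibleSheafRepresentativesLefAt : Prop :=
  ∀ C : ChernCharacterBetti, Ring2.SemiregularRepresentatives.AdmissibleRepresentativesLefAt (bfSheafClass C)

-- earlier Assembly (stmt-HodgeConjecture-19785, replaced 2026-08-26T09:17:30Z -> stmt-HodgeConjecture-19539): retired by None — ChernCharacterOnBetti → SemiregularSheafRepresentativesLefAt → BuchweitzFlennerSheafDoor → RaynaudSectionProjective → AndreCMAnchoredPencil → AndreAnchoredPencilsAlgebraic → Summit.HodgeConjecture.HodgeConjecture.Theses.PadicSemiregularLift.HodgeAbelianVarieties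
/-- item stmt-HodgeConjecture-19539 · assembly · rank 1 · closed · proved by Summit.HodgeConjecture.HodgeConjecture.Theorems.vhcAbelianSchemesRoad_assembly_proof (prover) · by planner
sources: BuchweitzFlenner2003, Andre1996Motifs, Grothendieck1966
[assembly] ChernCharacterOnBetti → SemiregularSheafRepresentativesTwAt → TwistedPerfectDoor →
RaynaudSectionProjective → AndreCMAnchoredPencil → AndreAnchoredPencilsAlgebraic → HC_AV (the leaf)
— the chain `closes` consumes since rev 5 (the twin over the twisted door; provable outright from
`closes`); the pre-twin chain through SemiregularSheafRepresentativesLefAt ∕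
BuchweitzFlennerSheafDoor (items 19779 ∕ 19781, aside since rev 8) is retired from this item
(tribunal J note rev 10 (b)). -/
@[route_item "route-HodgeConjecture-VHCAbelianSchemesRoad"]
def Assembly : Prop :=
  ChernCharacterOnBetti → SemiregularSheafRepresentativesTwAt → TwistedPerfectDoor → RaynaudSectionProjective → AndreCMAnchoredPencil → AndreAnchoredPencilsAlgebraic → Summit.HodgeConjecture.HodgeConjecture.Theses.PadicSemiregularLift.HodgeAbelianVarieties

-- `Assembly` holds: proved by `Summit.HodgeConjecture.HodgeConjecture.Theorems.vhcAbelianSchemesRoad_assembly_proof` (its module imports this route file, so no `_holds` link can be stated here).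

/-! D-0027 §2.1 — DECIDING THEOREM (planner-authored via `route open/edit --closes-file`; by planner-pub-hodge-ring2-typer1-g158-0 2026-08-27T22:48:54Z):
its hypotheses are this route's items and its conclusion the registered leaf `Summit.HodgeConjecture.HodgeConjecture.Theses.PadicSemiregularLift.HodgeAbelianVarieties` (rung H1, D-0061) (glue_lint), and it elaborates with this file. -/

@[closes "route-HodgeConjecture-VHCAbelianSchemesRoad"] theorem closes (hC : ChernCharacterOnBetti) (hDiagLoc : SemiregularSheafRepresentativesTwPrimeAtDiagLocal)
    (hDoor : TwistedPerfectDoorPrime) (hR : RaynaudSectionProjective) (h₂₁ : AndreCMAnchoredPencil)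
    (h₂₂ : AndreAnchoredPencilsAlgebraic) :
    Summit.HodgeConjecture.HodgeConjecture.Theses.PadicSemiregularLift.HodgeAbelianVarieties :=
  Summit.HodgeConjecture.HodgeConjecture.Ring2.SemiregularRepresentatives.hc_av_of_exceptionalRegimeAtLocal_admTw'_diagonal_two
    hC hDiagLoc hDoor hR h₂₁ h₂₂

end Summit.HodgeConjecture.HodgeConjecture.Theses.VHCAbelianSchemesRoad
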